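import Literature.Topology.FourManifolds.Isotopy
import Literature.Topology.FourManifolds.TubeSurgery
import Literature.Topology.FourManifolds.LinkingNumberProofs
import Mathlib.Geometry.Manifold.ContMDiffMFDeriv
import HarnessLib

/-!
# Pushing compactly supported isotopies of the tube `S¹ × ℝ²` into a 3-manifold along disjoint tubes

Topic `Literature/Topology/FourManifolds`; infrastructure for the uniqueness of Dehn surgery on a
framed link (`Literature.Topology.FourManifolds.FramedLink.IsSurgery.nonempty_diffeomorph`, `KirbyMovesSurgery.lean`, leaf (U) of
Kirby's theorem `Literature.Topology.FourManifolds.KirbyEquivalent.nonempty_diffeomorph`). Everything here is proved.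

Let `ν i : S¹ × ℝ² ↪ X` be tubes (`Literature.Topology.FourManifolds.TubeNbhd`, `TubeSurgery.lean`: open smooth embeddings
with zero section a circle `c i`) in a Hausdorff 3-manifold `X` charted on `ℝ³`, finitely many,
with pairwise disjoint images, and let `Θ i` be **compactly supported isotopies of the tube**
(`Literature.Topology.FourManifolds.TubeIsotopy`: ambient isotopies of `S¹ × ℝ²` in the sense of `Literature.Topology.FourManifolds.AmbientIsotopy`,
`Isotopy.lean`, all of whose stages are the identity off one tube `S¹ × B̄_R`). We construct the
**push-forward ambient isotopy** `Literature.TubeNbhd.tubeIsotopyPush ν hdisj Θ` of `X`: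
`ν i p ↦ ν i (Θ i t p)` on the image of `ν i` and the identity elsewhere — the standard extension
by the identity of a compactly supported diffeotopy of an open subset (M. W. Hirsch,
*Differential Topology* (1976), Ch. 8 §1, p. 179: "an isotopy of `V` with compact support
extends, by the identity, to an isotopy of `M`"; here `V = ⊔ᵢ ν i (S¹ × ℝ²)`), jointly smooth
because `ν i` has a smooth inverse on its open image (`TubeNbhd.toHomeo`,
`TubeNbhd.contMDiffOn_toHomeo_symm`, loc. cit.). For oriented tubular neighbourhoods of the
components of a link in `S³` (`Literature.Topology.FourManifolds.Knot.TubularNbhd`, a tube by `Knot.TubularNbhd.toTubeNbhd`)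
this is `Literature.Topology.FourManifolds.Link.tubeIsotopyPush`.

Downstream the fibre rescalings `(x, w) ↦ (x, h_t w)` and the fibre twists
`(x, w) ↦ (x, R(t χ(‖w‖²) α x) w)` of the tube are pushed into `S³` this way, so that the
transport of surgery presentations along ambient isotopies (`KirbyMovesIsotopyProofs.lean`:
orientation `det_pos` and framing integers are preserved along isotopies) applies to them.

* `Literature.Topology.FourManifolds.TubeIsotopy` — compactly supported ambient isotopies of `S¹ × ℝ²` (`extends
  AmbientIsotopy`); `TubeIsotopy.refl`; the inverse stages `TubeIsotopy.invFun`;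
* `Literature.TubeNbhd.tubePush ν Φ` — the simultaneous push-forward of self-maps `Φ i` of the tube
  along the `ν i`; `Literature.Topology.FourManifolds.TubeNbhd.contMDiff_tubePush_family` — joint smoothness for smooth
  families supported in a fixed tube; `Literature.Topology.FourManifolds.TubeNbhd.tubePushDiffeo`;
* `Literature.TubeNbhd.tubeIsotopyPush ν hdisj Θ : AmbientIsotopy (𝓡 3) X` and its values
  (`tubeIsotopyPush_apply_toFun`, `tubeIsotopyPush_apply_of_forall_not_mem`,
  `tubeIsotopyPush_apply_curve`);
* `Literature.Topology.FourManifolds.Link.tubeIsotopyPush` — the case of oriented tubular neighbourhoods of a link in `S³`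
  (`tubeIsotopyPush_apply_coe`, `tubeIsotopyPush_apply_component`).

## References

* M. W. Hirsch, *Differential Topology*, GTM 33, Springer (1976), Ch. 8 §1 (isotopies with
  compact support; extension by the identity), Ch. 4 §5 (tubular neighbourhoods). [Hirsch1976]
* A. Kosinski, *Differential Manifolds*, Academic Press (1993), Ch. III §3. [Kosinski1993]

## Design notes

* The tree's `Literature.Topology.FourManifolds.TwoKnot.TubularNbhd.pushforwardDiffeo` (`GluckTwistLocality.lean`) is the same
  device for one tubular neighbourhood `S² × ℝ² ↪ S⁴` and one diffeomorphism; here we need the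
  version with a time parameter (an *isotopy*, so that `det_pos` and framings are transported by
  `KirbyMovesIsotopyProofs.lean`) and for finitely many disjoint tubes at once.
* `TubeIsotopy` extends `Literature.AmbientIsotopy I𝕋₁ (𝕊 1 × ℝ²)` by a supporting radius; the inverse
  stages are those of `AmbientIsotopy.toDiffeomorph`.
* Everything in this file is proved; no named facts are introduced; no `sorry`.
-/

noncomputable section

open Set Function Metric Filter
open scoped Manifold ContDiff Topology

namespace Literature.Topology.FourManifolds

universe u

/-- Local notation: `𝔼 n` is the model Euclidean space `EuclideanSpace ℝ (Fin n)`. -/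
local notation "𝔼 " n:arg => EuclideanSpace ℝ (Fin n)

/-- Local notation: `𝕊 n` is the unit sphere in `EuclideanSpace ℝ (Fin (n + 1))`. -/
local notation "𝕊 " n:arg => (Metric.sphere (0 : EuclideanSpace ℝ (Fin (n + 1))) 1)

/-- Local notation: the model with corners of the tube `𝕊 1 × ℝ²`. -/
local notation "I𝕋₁" => (ModelWithCorners.prod (𝓡 1) 𝓘(ℝ, EuclideanSpace ℝ (Fin 2)))

/-! ### Compactly supported isotopies of the tube `𝕊 1 × ℝ²` -/

/-- A **compactly supported isotopy of the tube** `S¹ × ℝ²`: an ambient isotopy `Θ t`, `t ∈ ℝ`, of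
`S¹ × ℝ²` (`Literature.Topology.FourManifolds.AmbientIsotopy`: jointly `C^∞`, every stage a diffeomorphism, `Θ 0 = id`) all of
whose stages are the identity off one tube `S¹ × B̄_R`, `R = Θ.radius` (Hirsch, *Differential
Topology* (1976), Ch. 8 §1, p. 178: isotopies and diffeotopies with compact support
`Supp F ⊆ V × I`). [cite: Hirsch1976, Ch. 8 §1] -/
structure TubeIsotopy extends AmbientIsotopy I𝕋₁ ((𝕊 1) × 𝔼 2) where
  /-- The radius of a supporting tube. -/
  radius : ℝ
  /-- Every stage is the identity off the tube `S¹ × B̄_radius`. -/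
  eq_self : ∀ t p, radius ≤ ‖p.2‖ → toFun t p = p

namespace TubeIsotopy

variable (Θ : TubeIsotopy)

/-- Each stage of a tube isotopy is smooth. [folklore] -/
theorem contMDiff_toFun (t : ℝ) : ContMDiff I𝕋₁ I𝕋₁ ∞ (Θ.toFun t) :=
  Θ.toAmbientIsotopy.contMDiff_toFun t

/-- The stage `0` of a tube isotopy is the identity. [folklore] -/
@[simp] theorem toFun_zero_apply (p : (𝕊 1) × 𝔼 2) : Θ.toFun 0 p = p := by
  rw [Θ.map_zero]; rfl

/-- The **inverse stages** of a tube isotopy (the inverses of the stage diffeomorphisms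
`AmbientIsotopy.toDiffeomorph`). [folklore] -/
def invFun (t : ℝ) : (𝕊 1) × 𝔼 2 → (𝕊 1) × 𝔼 2 := ⇑(Θ.toAmbientIsotopy.toDiffeomorph t).symm

/-- `invFun t` is a left inverse of the stage `t`. [folklore] -/
@[simp] theorem invFun_toFun (t : ℝ) (p : (𝕊 1) × 𝔼 2) : Θ.invFun t (Θ.toFun t p) = p :=
  (Θ.toAmbientIsotopy.toDiffeomorph t).symm_apply_apply p

/-- `invFun t` is a right inverse of the stage `t`. [folklore] -/
@[simp] theorem toFun_invFun (t : ℝ) (p : (𝕊 1) × 𝔼 2) : Θ.toFun t (Θ.invFun t p) = p :=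
  (Θ.toAmbientIsotopy.toDiffeomorph t).apply_symm_apply p

/-- The inverse stages are smooth. [folklore] -/
theorem contMDiff_invFun (t : ℝ) : ContMDiff I𝕋₁ I𝕋₁ ∞ (Θ.invFun t) :=
  (Θ.toAmbientIsotopy.toDiffeomorph t).symm.contMDiff

/-- The inverse stages are also the identity off the supporting tube. [folklore] -/
theorem invFun_eq_self (t : ℝ) (p : (𝕊 1) × 𝔼 2) (hp : Θ.radius ≤ ‖p.2‖) : Θ.invFun t p = p := by
  conv_lhs => rw [← Θ.eq_self t p hp]
  exact Θ.invFun_toFun t p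

/-- The **trivial tube isotopy**, constant equal to the identity. [folklore] -/
protected def refl : TubeIsotopy where
  toAmbientIsotopy := AmbientIsotopy.refl
  radius := 0
  eq_self _ _ _ := rfl

/-- Stages of the trivial tube isotopy. [folklore] -/
@[simp] theorem refl_toFun (t : ℝ) (p : (𝕊 1) × 𝔼 2) : TubeIsotopy.refl.toFun t p = p := rfl

end TubeIsotopy

/-! ### The simultaneous push-forward along disjoint tubes in a 3-manifold -/

namespace TubeNbhd

variable {X : Type u} [TopologicalSpace X] [ChartedSpace (𝔼 3) X]
  {ι : Type*} {c : ι → (𝕊 1) → X} (ν : ∀ i, TubeNbhd (𝓡 3) (c i))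

/-- `ν ∘ ν⁻¹ = id` on the range of a tube. [folklore] -/
theorem apply_toHomeo_symm {c₀ : (𝕊 1) → X} (ν₀ : TubeNbhd (𝓡 3) c₀) {p : X}
    (hp : p ∈ range ν₀.toFun) : ν₀.toFun (ν₀.toHomeo.symm p) = p := by
  have h := ν₀.toHomeo.right_inv (show p ∈ ν₀.toHomeo.target by rw [ν₀.toHomeo_target]; exact hp)
  simpa using h

/-- The inverse of a tube is `C^∞` at the points of its (open) range. [folklore] -/
theorem contMDiffAt_toHomeo_symm {c₀ : (𝕊 1) → X} (ν₀ : TubeNbhd (𝓡 3) c₀) {p : X}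
    (hp : p ∈ range ν₀.toFun) : ContMDiffAt (𝓡 3) I𝕋₁ ∞ ν₀.toHomeo.symm p :=
  ν₀.contMDiffOn_toHomeo_symm.contMDiffAt (ν₀.isOpen_range.mem_nhds hp)

/-- The image of a closed tube `𝕊 1 × B̄_R` under a tube map is compact, hence closed (`X`
Hausdorff). [folklore] -/
theorem isClosed_image_closedTube [T2Space X] {c₀ : (𝕊 1) → X} (ν₀ : TubeNbhd (𝓡 3) c₀) (R : ℝ) :
    IsClosed (ν₀.toFun '' (univ ×ˢ closedBall (0 : 𝔼 2) R)) :=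
  ((isCompact_univ.prod (isCompact_closedBall _ _)).image ν₀.continuous).isClosed

/-- Tubes with pairwise disjoint images: a point lies in the image of at most one of them.
[folklore] -/
theorem index_eq_of_mem_range
    (hdisj : Pairwise fun i j => Disjoint (range (ν i).toFun) (range (ν j).toFun)) {p : X}
    {i j : ι} (hi : p ∈ range (ν i).toFun) (hj : p ∈ range (ν j).toFun) : i = j := by
  by_contra h
  exact Set.disjoint_left.1 (hdisj h) hi hj

open Classical in
/-- The **simultaneous push-forward** along the tubes `ν i` of self-maps `Φ i` of `S¹ × ℝ²`,
extended by the identity: `ν i p ↦ ν i (Φ i p)` on the image of `ν i`, `y ↦ y` off all the images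
(well defined when the images are pairwise disjoint). Hirsch (1976), Ch. 8 §1 (extension by the
identity). [folklore] -/
def tubePush (Φ : ∀ _i : ι, (𝕊 1) × 𝔼 2 → (𝕊 1) × 𝔼 2) (y : X) : X :=
  if h : ∃ i, y ∈ range (ν i).toFun then
    (ν h.choose).toFun (Φ h.choose ((ν h.choose).toHomeo.symm y)) else y

variable {ν}

/-- The push-forward on the image of `ν i`. [folklore] -/
theorem tubePush_apply (hdisj : Pairwise fun i j => Disjoint (range (ν i).toFun) (range (ν j).toFun))
    (Φ : ∀ _i : ι, (𝕊 1) × 𝔼 2 → (𝕊 1) × 𝔼 2) (i : ι) (p : (𝕊 1) × 𝔼 2) :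
    tubePush ν Φ ((ν i).toFun p) = (ν i).toFun (Φ i p) := by
  have h : ∃ j, (ν i).toFun p ∈ range (ν j).toFun := ⟨i, p, rfl⟩
  rw [tubePush, dif_pos h]
  have key : ∀ j, (ν i).toFun p ∈ range (ν j).toFun →
      (ν j).toFun (Φ j ((ν j).toHomeo.symm ((ν i).toFun p))) = (ν i).toFun (Φ i p) := by
    intro j hj
    have hji : j = i := index_eq_of_mem_range ν hdisj hj ⟨p, rfl⟩
    subst hji
    rw [TubeNbhd.toHomeo_symm_apply]
  exact key _ h.choose_spec

/-- The push-forward off all the images is the identity. [folklore] -/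
theorem tubePush_of_forall_not_mem (Φ : ∀ _i : ι, (𝕊 1) × 𝔼 2 → (𝕊 1) × 𝔼 2) {y : X}
    (hy : ∀ i, y ∉ range (ν i).toFun) : tubePush ν Φ y = y := by
  have h : ¬ ∃ i, y ∈ range (ν i).toFun := fun ⟨i, hi⟩ => hy i hi
  rw [tubePush, dif_neg h]

/-- Push-forwards compose. [folklore] -/
theorem tubePush_tubePush (hdisj : Pairwise fun i j => Disjoint (range (ν i).toFun) (range (ν j).toFun))
    (Φ Ψ : ∀ _i : ι, (𝕊 1) × 𝔼 2 → (𝕊 1) × 𝔼 2) (y : X) :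
    tubePush ν Φ (tubePush ν Ψ y) = tubePush ν (fun i => Φ i ∘ Ψ i) y := by
  by_cases hy : ∃ i, y ∈ range (ν i).toFun
  · obtain ⟨i, p, rfl⟩ := hy
    rw [tubePush_apply hdisj, tubePush_apply hdisj, tubePush_apply hdisj]
    rfl
  · have hy' : ∀ i, y ∉ range (ν i).toFun := fun i hi => hy ⟨i, hi⟩
    rw [tubePush_of_forall_not_mem Ψ hy', tubePush_of_forall_not_mem Φ hy',
      tubePush_of_forall_not_mem _ hy']

/-- The push-forward of maps that are pointwise the identity is the identity. [folklore] -/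
theorem tubePush_eq_self_of_forall_eq
    (hdisj : Pairwise fun i j => Disjoint (range (ν i).toFun) (range (ν j).toFun))
    {Φ : ∀ _i : ι, (𝕊 1) × 𝔼 2 → (𝕊 1) × 𝔼 2} (hΦ : ∀ i p, Φ i p = p) (y : X) :
    tubePush ν Φ y = y := by
  by_cases hy : ∃ i, y ∈ range (ν i).toFun
  · obtain ⟨i, p, rfl⟩ := hy
    rw [tubePush_apply hdisj, hΦ]
  · exact tubePush_of_forall_not_mem Φ fun i hi => hy ⟨i, hi⟩

/-- Outside the images of the tubes `𝕊 1 × B̄_{R i}` the push-forward of maps supported in those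
tubes is the identity. [folklore] -/
theorem tubePush_eq_self_of_not_mem_image
    (hdisj : Pairwise fun i j => Disjoint (range (ν i).toFun) (range (ν j).toFun))
    {Φ : ∀ _i : ι, (𝕊 1) × 𝔼 2 → (𝕊 1) × 𝔼 2} {R : ι → ℝ}
    (hΦ : ∀ i (p : (𝕊 1) × 𝔼 2), R i ≤ ‖p.2‖ → Φ i p = p) {y : X}
    (hy : ∀ i, y ∉ (ν i).toFun '' (univ ×ˢ closedBall (0 : 𝔼 2) (R i))) : tubePush ν Φ y = y := by
  by_cases hy' : ∃ i, y ∈ range (ν i).toFun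
  · obtain ⟨i, p, rfl⟩ := hy'
    rw [tubePush_apply hdisj, hΦ i p]
    by_contra hp
    exact hy i ⟨p, ⟨mem_univ _, mem_closedBall_zero_iff.2 (not_le.1 hp).le⟩, rfl⟩
  · exact tubePush_of_forall_not_mem Φ fun i hi => hy' ⟨i, hi⟩

/-- **Joint smoothness of the push-forward of a smooth family.** If the self-maps `Φ i s` of the
tube depend smoothly on `(s, p)` and are the identity off fixed tubes `𝕊 1 × B̄_{R i}`, then
`(s, y) ↦ tubePush ν (Φ · s) y` is smooth on `ℝ × X`: near `ℝ × ν i (S¹ × ℝ²)` it is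
`ν i ∘ Φ i s ∘ (ν i)⁻¹` with `(ν i)⁻¹` smooth on the open image, and near the remaining points
(off the compact images of the closed tubes) it is the identity. [folklore] -/
theorem contMDiff_tubePush_family [Finite ι] [T2Space X]
    (hdisj : Pairwise fun i j => Disjoint (range (ν i).toFun) (range (ν j).toFun))
    {Φ : ∀ _i : ι, ℝ → (𝕊 1) × 𝔼 2 → (𝕊 1) × 𝔼 2}
    (hΦs : ∀ i, ContMDiff (𝓘(ℝ, ℝ).prod I𝕋₁) I𝕋₁ ∞ (uncurry (Φ i))) {R : ι → ℝ}
    (hΦ : ∀ i s (p : (𝕊 1) × 𝔼 2), R i ≤ ‖p.2‖ → Φ i s p = p) :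
    ContMDiff (𝓘(ℝ, ℝ).prod (𝓡 3)) (𝓡 3) ∞
      fun q : ℝ × X => tubePush ν (fun i => Φ i q.1) q.2 := by
  rintro ⟨s, y⟩
  by_cases hy : ∃ i, y ∈ range (ν i).toFun
  · obtain ⟨i, p, rfl⟩ := hy
    -- near `ℝ × range (ν i)` the map is `ν i ∘ Φ i s ∘ (ν i)⁻¹`
    have hg : ContMDiffAt (𝓘(ℝ, ℝ).prod (𝓡 3)) (𝓡 3) ∞
        (fun q : ℝ × X => (ν i).toFun (Φ i q.1 ((ν i).toHomeo.symm q.2))) (s, (ν i).toFun p) := by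
      have h1 : ContMDiffAt (𝓘(ℝ, ℝ).prod (𝓡 3)) (𝓘(ℝ, ℝ).prod I𝕋₁) ∞
          (fun q : ℝ × X => (q.1, (ν i).toHomeo.symm q.2)) (s, (ν i).toFun p) :=
        contMDiffAt_fst.prodMk
          (((ν i).contMDiffAt_toHomeo_symm ⟨p, rfl⟩).comp (s, (ν i).toFun p) contMDiffAt_snd)
      exact (ν i).contMDiff.contMDiffAt.comp (s, (ν i).toFun p)
        (((hΦs i) _).comp (s, (ν i).toFun p) h1)
    refine hg.congr_of_eventuallyEq ?_
    have hO : IsOpen {q : ℝ × X | q.2 ∈ range (ν i).toFun} :=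
      (ν i).isOpen_range.preimage continuous_snd
    filter_upwards [hO.mem_nhds (show (s, (ν i).toFun p) ∈ {q : ℝ × X | q.2 ∈ range (ν i).toFun}
      from ⟨p, rfl⟩)] with q hq
    obtain ⟨p', hp'⟩ := hq
    show tubePush ν (fun i => Φ i q.1) q.2 = (ν i).toFun (Φ i q.1 ((ν i).toHomeo.symm q.2))
    rw [← hp', tubePush_apply hdisj, TubeNbhd.toHomeo_symm_apply]
  · -- off the images of the closed tubes the map is the identity
    set C : Set X := ⋃ i, (ν i).toFun '' (univ ×ˢ closedBall (0 : 𝔼 2) (R i)) with hC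
    have hCc : IsClosed C :=
      isClosed_iUnion_of_finite fun i => (ν i).isClosed_image_closedTube (R i)
    have hyC : y ∉ C := by
      rw [hC, mem_iUnion]
      rintro ⟨i, hi⟩
      exact hy ⟨i, image_subset_range _ _ hi⟩
    have hO : IsOpen {q : ℝ × X | q.2 ∉ C} := hCc.isOpen_compl.preimage continuous_snd
    refine contMDiffAt_snd.congr_of_eventuallyEq ?_
    filter_upwards [hO.mem_nhds (show (s, y) ∈ {q : ℝ × X | q.2 ∉ C} from hyC)] with q hq
    refine tubePush_eq_self_of_not_mem_image hdisj (fun i p hp => hΦ i q.1 p hp) fun i hi => ?_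
    exact hq (mem_iUnion.2 ⟨i, hi⟩)

/-- Smoothness of the push-forward of smooth maps supported in fixed tubes (the time-independent
case of `contMDiff_tubePush_family`). [folklore] -/
theorem contMDiff_tubePush [Finite ι] [T2Space X]
    (hdisj : Pairwise fun i j => Disjoint (range (ν i).toFun) (range (ν j).toFun))
    {Φ : ∀ _i : ι, (𝕊 1) × 𝔼 2 → (𝕊 1) × 𝔼 2}
    (hΦs : ∀ i, ContMDiff I𝕋₁ I𝕋₁ ∞ (Φ i)) {R : ι → ℝ}
    (hΦ : ∀ i (p : (𝕊 1) × 𝔼 2), R i ≤ ‖p.2‖ → Φ i p = p) :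
    ContMDiff (𝓡 3) (𝓡 3) ∞ (tubePush ν Φ) := by
  have h := contMDiff_tubePush_family hdisj (Φ := fun i (_ : ℝ) => Φ i)
    (fun i => (hΦs i).comp contMDiff_snd) (fun i _ p hp => hΦ i p hp)
  exact h.comp (contMDiff_const (c := (0 : ℝ)).prodMk contMDiff_id)

/-- **The push-forward of compactly supported diffeomorphisms of the tube is a diffeomorphism**
(inverse: the push-forward of the inverses). Hirsch (1976), Ch. 8 §1. [folklore] -/
def tubePushDiffeo [Finite ι] [T2Space X]
    (hdisj : Pairwise fun i j => Disjoint (range (ν i).toFun) (range (ν j).toFun))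
    (Θ : ι → TubeIsotopy) (t : ℝ) : X ≃ₘ⟮𝓡 3, 𝓡 3⟯ X where
  toFun := tubePush ν fun i => (Θ i).toFun t
  invFun := tubePush ν fun i => (Θ i).invFun t
  left_inv y := by
    rw [tubePush_tubePush hdisj]
    exact tubePush_eq_self_of_forall_eq hdisj (fun i p => (Θ i).invFun_toFun t p) y
  right_inv y := by
    rw [tubePush_tubePush hdisj]
    exact tubePush_eq_self_of_forall_eq hdisj (fun i p => (Θ i).toFun_invFun t p) y
  contMDiff_toFun := contMDiff_tubePush hdisj (fun i => (Θ i).contMDiff_toFun t)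
    (R := fun i => (Θ i).radius) fun i p hp => (Θ i).eq_self t p hp
  contMDiff_invFun := contMDiff_tubePush hdisj (fun i => (Θ i).contMDiff_invFun t)
    (R := fun i => (Θ i).radius) fun i p hp => (Θ i).invFun_eq_self t p hp

/-- The push-forward diffeomorphism as a function. [folklore] -/
@[simp] theorem coe_tubePushDiffeo [Finite ι] [T2Space X]
    (hdisj : Pairwise fun i j => Disjoint (range (ν i).toFun) (range (ν j).toFun))
    (Θ : ι → TubeIsotopy) (t : ℝ) :
    ⇑(tubePushDiffeo hdisj Θ t) = tubePush ν fun i => (Θ i).toFun t := rfl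

variable (ν) in
/-- **The push-forward ambient isotopy.** For tubes `ν i` in a 3-manifold `X` with pairwise
disjoint images and compactly supported tube isotopies `Θ i`, the maps `ν i p ↦ ν i (Θ i t p)`
(identity off the images) form an ambient isotopy of `X` (`Literature.Topology.FourManifolds.AmbientIsotopy`): jointly smooth
(`contMDiff_tubePush_family`), each stage a diffeomorphism (`tubePushDiffeo`), the identity at
`t = 0`. Hirsch, *Differential Topology* (1976), Ch. 8 §1, p. 179 (an isotopy with compact
support of an open subset extends by the identity to an isotopy of the ambient manifold).
[cite: Hirsch1976, Ch. 8 §1] -/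
def tubeIsotopyPush [Finite ι] [T2Space X] [IsManifold (𝓡 3) ∞ X]
    (hdisj : Pairwise fun i j => Disjoint (range (ν i).toFun) (range (ν j).toFun))
    (Θ : ι → TubeIsotopy) : AmbientIsotopy (𝓡 3) X where
  toFun t := tubePush ν fun i => (Θ i).toFun t
  contMDiff := contMDiff_tubePush_family hdisj (Φ := fun i => (Θ i).toFun)
    (fun i => (Θ i).contMDiff) (R := fun i => (Θ i).radius) fun i s p hp => (Θ i).eq_self s p hp
  bijective t := (tubePushDiffeo hdisj Θ t).bijective
  isLocalDiffeomorph t := (tubePushDiffeo hdisj Θ t).isLocalDiffeomorph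
  map_zero := funext fun y =>
    tubePush_eq_self_of_forall_eq hdisj (fun i p => (Θ i).toFun_zero_apply p) y

/-- The stages of the push-forward isotopy, as functions. [folklore] -/
theorem tubeIsotopyPush_toFun [Finite ι] [T2Space X] [IsManifold (𝓡 3) ∞ X]
    (hdisj : Pairwise fun i j => Disjoint (range (ν i).toFun) (range (ν j).toFun))
    (Θ : ι → TubeIsotopy) (t : ℝ) :
    (tubeIsotopyPush ν hdisj Θ).toFun t = tubePush ν fun i => (Θ i).toFun t := rfl

/-- **The push-forward isotopy intertwines `ν i` with the tube isotopy `Θ i`**: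
`F t (ν i p) = ν i (Θ i t p)`. [folklore] -/
@[simp] theorem tubeIsotopyPush_apply_toFun [Finite ι] [T2Space X] [IsManifold (𝓡 3) ∞ X]
    (hdisj : Pairwise fun i j => Disjoint (range (ν i).toFun) (range (ν j).toFun))
    (Θ : ι → TubeIsotopy) (t : ℝ) (i : ι) (p : (𝕊 1) × 𝔼 2) :
    (tubeIsotopyPush ν hdisj Θ).toFun t ((ν i).toFun p) = (ν i).toFun ((Θ i).toFun t p) :=
  tubePush_apply hdisj (fun i => (Θ i).toFun t) i p

/-- The push-forward isotopy is the identity off the images of the `ν i`. [folklore] -/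
theorem tubeIsotopyPush_apply_of_forall_not_mem [Finite ι] [T2Space X] [IsManifold (𝓡 3) ∞ X]
    (hdisj : Pairwise fun i j => Disjoint (range (ν i).toFun) (range (ν j).toFun))
    (Θ : ι → TubeIsotopy) (t : ℝ) {y : X} (hy : ∀ i, y ∉ range (ν i).toFun) :
    (tubeIsotopyPush ν hdisj Θ).toFun t y = y :=
  tubePush_of_forall_not_mem (fun i => (Θ i).toFun t) hy

/-- **The push-forward isotopy fixes the core circles** as soon as the tube isotopies fix the
zero section. [folklore] -/
theorem tubeIsotopyPush_apply_curve [Finite ι] [T2Space X] [IsManifold (𝓡 3) ∞ X]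
    (hdisj : Pairwise fun i j => Disjoint (range (ν i).toFun) (range (ν j).toFun))
    (Θ : ι → TubeIsotopy) (h0 : ∀ i t (x : 𝕊 1), (Θ i).toFun t (x, 0) = (x, 0)) (t : ℝ) (i : ι)
    (x : 𝕊 1) : (tubeIsotopyPush ν hdisj Θ).toFun t (c i x) = c i x := by
  rw [← (ν i).apply_zero, tubeIsotopyPush_apply_toFun, h0]

end TubeNbhd

/-! ### The case of tubular neighbourhoods of a link in `S³` -/

namespace Link

variable {ι : Type*} [Finite ι] {L : Link ι} (ν : ∀ i, Knot.TubularNbhd (L.component i))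

/-- **The push-forward ambient isotopy of `S³`** along oriented tubular neighbourhoods `ν i`
(pairwise disjoint images) of the components of a link, of compactly supported tube isotopies
`Θ i`: `ν i p ↦ ν i (Θ i t p)`, the identity elsewhere (`TubeNbhd.tubeIsotopyPush` for the tubes
`(ν i).toTubeNbhd`). Hirsch (1976), Ch. 8 §1. [cite: Hirsch1976, Ch. 8 §1] -/
def tubeIsotopyPush (hdisj : Pairwise fun i j => Disjoint (range (ν i)) (range (ν j)))
    (Θ : ι → TubeIsotopy) : AmbientIsotopy (𝓡 3) (𝕊 3) :=
  TubeNbhd.tubeIsotopyPush (fun i => (ν i).toTubeNbhd) hdisj Θ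

variable {ν}

/-- **The push-forward isotopy intertwines `ν i` with `Θ i`**: `F t (ν i p) = ν i (Θ i t p)`.
[folklore] -/
@[simp] theorem tubeIsotopyPush_apply_coe
    (hdisj : Pairwise fun i j => Disjoint (range (ν i)) (range (ν j)))
    (Θ : ι → TubeIsotopy) (t : ℝ) (i : ι) (p : (𝕊 1) × 𝔼 2) :
    (tubeIsotopyPush ν hdisj Θ).toFun t (ν i p) = ν i ((Θ i).toFun t p) :=
  TubeNbhd.tubeIsotopyPush_apply_toFun hdisj Θ t i p

/-- The push-forward isotopy is the identity off the images of the `ν i`. [folklore] -/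
theorem tubeIsotopyPush_apply_of_forall_not_mem
    (hdisj : Pairwise fun i j => Disjoint (range (ν i)) (range (ν j)))
    (Θ : ι → TubeIsotopy) (t : ℝ) {y : 𝕊 3} (hy : ∀ i, y ∉ range (ν i)) :
    (tubeIsotopyPush ν hdisj Θ).toFun t y = y :=
  TubeNbhd.tubeIsotopyPush_apply_of_forall_not_mem hdisj Θ t hy

/-- **The push-forward isotopy fixes the link** as soon as the tube isotopies fix the zero
section. [folklore] -/
theorem tubeIsotopyPush_apply_component
    (hdisj : Pairwise fun i j => Disjoint (range (ν i)) (range (ν j)))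
    (Θ : ι → TubeIsotopy) (h0 : ∀ i t (x : 𝕊 1), (Θ i).toFun t (x, 0) = (x, 0)) (t : ℝ) (i : ι)
    (x : 𝕊 1) : (tubeIsotopyPush ν hdisj Θ).toFun t (L.component i x) = L.component i x :=
  TubeNbhd.tubeIsotopyPush_apply_curve hdisj Θ h0 t i x

end Link

end Literature.Topology.FourManifolds

end
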